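import Summits.Ventures.YMGap.RobustBall.RobustAreaLawVertexW
import HarnessLib

/-!
# Robust ball (Y2), area-law side — the certified FRONTIER of the tier-2 vertex door for `SU(2)`, `d = 4`, `κ = log(6/5)`

HONEST FRAMING: venture file of the cell `pub-ymgap` (QuantumFields programme), track ROBUST-BALL (ds-4).  ROWS only: the largest one-parameter
radius `ε` (at resolution `1/1000`) certified by the affine-vertex tier-2 door `su2_areaLawOnBallW_vertex_of_row`
(`rhoFR 2 (e^{κ/3}·3β_W/2) (2ε) ε < 1`) under the certificate form `(6/5)^{1/3} ≤ 1.0627`, `e^{2ε} ≤ T₄(2ε)`, `√2 ≤ 1.41422` — the tier-2 twin of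
rb-p2's tier-1 frontier `AreaLawFrontierSU2`: `(β_W, ε) = (1/10, .436) (1/8, .395) (1/6, .331) (1/5, .279) (1/4, .218) (3/10, .171) (1/3, .144)
(2/5, .100) (9/20, .072) (1/2, .048) (11/20, .027) (3/5, .009)`; the weighted door closes at `e^{κ/3}·3β_W/2 = 1`, i.e. `β_W ≈ 0.627` (tier 1:
`2/3`).  Each cell: Wilson's AREA LAW holds uniformly on `ClusterDomain (log 6/5) (2ε) ε ∩ IsSlabLocal mv` (no range cut-off) on every torus.
Float optimum of the sharp vertex step ≤ .001 above each cell.  Strong-coupling finite-lattice statements; nothing about the continuum or Clay.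
-/

noncomputable section

open MeasureTheory ProbabilityTheory Real

namespace Summit.Ventures.YMGap.RobustBall

/-- Tier-2 vertex FRONTIER cell `(β_W, ε) = (1 / 10, .436)` at `κ = log(6/5)`: `AreaLawOnBallW 2 4 (1 / 20) (log(6/5)) (109 / 125) (109 / 250) mv`,
every `mv ≥ 1`; `ε` maximal at `1/1000` under the certificate form. [folklore] -/
theorem su2_areaLawOnBallW_frontier_oneTenth {mv : ℕ} (hmv : 1 ≤ mv) :
    AreaLawOnBallW 2 4 (1 / 20) (Real.log (6 / 5)) (109 / 125) (109 / 250) mv := by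
  rw [show (1 / 20 : ℝ) = 1 / 10 / 2 by norm_num]
  refine su2_areaLawOnBallW_vertex_of_row (βW := 1 / 10) (by norm_num) (by norm_num) (Real.log_pos (by norm_num)) (by norm_num) hmv ?_
  exact rhoFR_two_lt_one_of_bounds (by norm_num) (by norm_num) exp_log_six_fifths_div_three_le
    (exp_le_taylor4 (x := 109 / 125) (by norm_num) (by norm_num)) sqrt_two_le (by norm_num) (by norm_num)

/-- Tier-2 vertex FRONTIER cell `(β_W, ε) = (1 / 8, .395)` at `κ = log(6/5)`: `AreaLawOnBallW 2 4 (1 / 16) (log(6/5)) (79 / 100) (79 / 200) mv`,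
every `mv ≥ 1`; `ε` maximal at `1/1000` under the certificate form. [folklore] -/
theorem su2_areaLawOnBallW_frontier_oneEighth {mv : ℕ} (hmv : 1 ≤ mv) :
    AreaLawOnBallW 2 4 (1 / 16) (Real.log (6 / 5)) (79 / 100) (79 / 200) mv := by
  rw [show (1 / 16 : ℝ) = 1 / 8 / 2 by norm_num]
  refine su2_areaLawOnBallW_vertex_of_row (βW := 1 / 8) (by norm_num) (by norm_num) (Real.log_pos (by norm_num)) (by norm_num) hmv ?_
  exact rhoFR_two_lt_one_of_bounds (by norm_num) (by norm_num) exp_log_six_fifths_div_three_le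
    (exp_le_taylor4 (x := 79 / 100) (by norm_num) (by norm_num)) sqrt_two_le (by norm_num) (by norm_num)

/-- Tier-2 vertex FRONTIER cell `(β_W, ε) = (1 / 6, .331)` at `κ = log(6/5)`: `AreaLawOnBallW 2 4 (1 / 12) (log(6/5)) (331 / 500) (331 / 1000) mv`,
every `mv ≥ 1`; `ε` maximal at `1/1000` under the certificate form. [folklore] -/
theorem su2_areaLawOnBallW_frontier_oneSixth {mv : ℕ} (hmv : 1 ≤ mv) :
    AreaLawOnBallW 2 4 (1 / 12) (Real.log (6 / 5)) (331 / 500) (331 / 1000) mv := by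
  rw [show (1 / 12 : ℝ) = 1 / 6 / 2 by norm_num]
  refine su2_areaLawOnBallW_vertex_of_row (βW := 1 / 6) (by norm_num) (by norm_num) (Real.log_pos (by norm_num)) (by norm_num) hmv ?_
  exact rhoFR_two_lt_one_of_bounds (by norm_num) (by norm_num) exp_log_six_fifths_div_three_le
    (exp_le_taylor4 (x := 331 / 500) (by norm_num) (by norm_num)) sqrt_two_le (by norm_num) (by norm_num)

/-- Tier-2 vertex FRONTIER cell `(β_W, ε) = (1 / 5, .279)` at `κ = log(6/5)`: `AreaLawOnBallW 2 4 (1 / 10) (log(6/5)) (279 / 500) (279 / 1000) mv`,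
every `mv ≥ 1`; `ε` maximal at `1/1000` under the certificate form. [folklore] -/
theorem su2_areaLawOnBallW_frontier_oneFifth {mv : ℕ} (hmv : 1 ≤ mv) :
    AreaLawOnBallW 2 4 (1 / 10) (Real.log (6 / 5)) (279 / 500) (279 / 1000) mv := by
  rw [show (1 / 10 : ℝ) = 1 / 5 / 2 by norm_num]
  refine su2_areaLawOnBallW_vertex_of_row (βW := 1 / 5) (by norm_num) (by norm_num) (Real.log_pos (by norm_num)) (by norm_num) hmv ?_
  exact rhoFR_two_lt_one_of_bounds (by norm_num) (by norm_num) exp_log_six_fifths_div_three_le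
    (exp_le_taylor4 (x := 279 / 500) (by norm_num) (by norm_num)) sqrt_two_le (by norm_num) (by norm_num)

/-- Tier-2 vertex FRONTIER cell `(β_W, ε) = (1 / 4, .218)` at `κ = log(6/5)`: `AreaLawOnBallW 2 4 (1 / 8) (log(6/5)) (109 / 250) (109 / 500) mv`,
every `mv ≥ 1`; `ε` maximal at `1/1000` under the certificate form. [folklore] -/
theorem su2_areaLawOnBallW_frontier_oneQuarter {mv : ℕ} (hmv : 1 ≤ mv) :
    AreaLawOnBallW 2 4 (1 / 8) (Real.log (6 / 5)) (109 / 250) (109 / 500) mv := by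
  rw [show (1 / 8 : ℝ) = 1 / 4 / 2 by norm_num]
  refine su2_areaLawOnBallW_vertex_of_row (βW := 1 / 4) (by norm_num) (by norm_num) (Real.log_pos (by norm_num)) (by norm_num) hmv ?_
  exact rhoFR_two_lt_one_of_bounds (by norm_num) (by norm_num) exp_log_six_fifths_div_three_le
    (exp_le_taylor4 (x := 109 / 250) (by norm_num) (by norm_num)) sqrt_two_le (by norm_num) (by norm_num)

/-- Tier-2 vertex FRONTIER cell `(β_W, ε) = (3 / 10, .171)` at `κ = log(6/5)`: `AreaLawOnBallW 2 4 (3 / 20) (log(6/5)) (171 / 500) (171 / 1000) mv`,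
every `mv ≥ 1`; `ε` maximal at `1/1000` under the certificate form. [folklore] -/
theorem su2_areaLawOnBallW_frontier_threeTenths {mv : ℕ} (hmv : 1 ≤ mv) :
    AreaLawOnBallW 2 4 (3 / 20) (Real.log (6 / 5)) (171 / 500) (171 / 1000) mv := by
  rw [show (3 / 20 : ℝ) = 3 / 10 / 2 by norm_num]
  refine su2_areaLawOnBallW_vertex_of_row (βW := 3 / 10) (by norm_num) (by norm_num) (Real.log_pos (by norm_num)) (by norm_num) hmv ?_
  exact rhoFR_two_lt_one_of_bounds (by norm_num) (by norm_num) exp_log_six_fifths_div_three_le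
    (exp_le_taylor4 (x := 171 / 500) (by norm_num) (by norm_num)) sqrt_two_le (by norm_num) (by norm_num)

/-- Tier-2 vertex FRONTIER cell `(β_W, ε) = (1 / 3, .144)` at `κ = log(6/5)`: `AreaLawOnBallW 2 4 (1 / 6) (log(6/5)) (36 / 125) (18 / 125) mv`,
every `mv ≥ 1`; `ε` maximal at `1/1000` under the certificate form. [folklore] -/
theorem su2_areaLawOnBallW_frontier_oneThird {mv : ℕ} (hmv : 1 ≤ mv) :
    AreaLawOnBallW 2 4 (1 / 6) (Real.log (6 / 5)) (36 / 125) (18 / 125) mv := by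
  rw [show (1 / 6 : ℝ) = 1 / 3 / 2 by norm_num]
  refine su2_areaLawOnBallW_vertex_of_row (βW := 1 / 3) (by norm_num) (by norm_num) (Real.log_pos (by norm_num)) (by norm_num) hmv ?_
  exact rhoFR_two_lt_one_of_bounds (by norm_num) (by norm_num) exp_log_six_fifths_div_three_le
    (exp_le_taylor4 (x := 36 / 125) (by norm_num) (by norm_num)) sqrt_two_le (by norm_num) (by norm_num)

/-- Tier-2 vertex FRONTIER cell `(β_W, ε) = (2 / 5, .100)` at `κ = log(6/5)`: `AreaLawOnBallW 2 4 (1 / 5) (log(6/5)) (1 / 5) (1 / 10) mv`,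
every `mv ≥ 1`; `ε` maximal at `1/1000` under the certificate form. [folklore] -/
theorem su2_areaLawOnBallW_frontier_twoFifths {mv : ℕ} (hmv : 1 ≤ mv) :
    AreaLawOnBallW 2 4 (1 / 5) (Real.log (6 / 5)) (1 / 5) (1 / 10) mv := by
  have h := su2_areaLawOnBallW_vertex_of_row (βW := 2 / 5) (ε₀ := 1 / 5) (ε₁ := 1 / 10) (by norm_num) (by norm_num)
    (Real.log_pos (by norm_num)) (by norm_num) hmv
    (rhoFR_two_lt_one_of_bounds (by norm_num) (by norm_num) exp_log_six_fifths_div_three_le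
      (exp_le_taylor4 (x := 1 / 5) (by norm_num) (by norm_num)) sqrt_two_le (by norm_num) (by norm_num))
  rw [show (2 / 5 / 2 : ℝ) = 1 / 5 by norm_num] at h
  exact h

/-- Tier-2 vertex FRONTIER cell `(β_W, ε) = (9 / 20, .072)` at `κ = log(6/5)`: `AreaLawOnBallW 2 4 (9 / 40) (log(6/5)) (18 / 125) (9 / 125) mv`,
every `mv ≥ 1`; `ε` maximal at `1/1000` under the certificate form. [folklore] -/
theorem su2_areaLawOnBallW_frontier_nineTwentieths {mv : ℕ} (hmv : 1 ≤ mv) :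
    AreaLawOnBallW 2 4 (9 / 40) (Real.log (6 / 5)) (18 / 125) (9 / 125) mv := by
  rw [show (9 / 40 : ℝ) = 9 / 20 / 2 by norm_num]
  refine su2_areaLawOnBallW_vertex_of_row (βW := 9 / 20) (by norm_num) (by norm_num) (Real.log_pos (by norm_num)) (by norm_num) hmv ?_
  exact rhoFR_two_lt_one_of_bounds (by norm_num) (by norm_num) exp_log_six_fifths_div_three_le
    (exp_le_taylor4 (x := 18 / 125) (by norm_num) (by norm_num)) sqrt_two_le (by norm_num) (by norm_num)

/-- Tier-2 vertex FRONTIER cell `(β_W, ε) = (1 / 2, .048)` at `κ = log(6/5)`: `AreaLawOnBallW 2 4 (1 / 4) (log(6/5)) (12 / 125) (6 / 125) mv`,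
every `mv ≥ 1`; `ε` maximal at `1/1000` under the certificate form. [folklore] -/
theorem su2_areaLawOnBallW_frontier_oneHalf {mv : ℕ} (hmv : 1 ≤ mv) :
    AreaLawOnBallW 2 4 (1 / 4) (Real.log (6 / 5)) (12 / 125) (6 / 125) mv := by
  rw [show (1 / 4 : ℝ) = 1 / 2 / 2 by norm_num]
  refine su2_areaLawOnBallW_vertex_of_row (βW := 1 / 2) (by norm_num) (by norm_num) (Real.log_pos (by norm_num)) (by norm_num) hmv ?_
  exact rhoFR_two_lt_one_of_bounds (by norm_num) (by norm_num) exp_log_six_fifths_div_three_le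
    (exp_le_taylor4 (x := 12 / 125) (by norm_num) (by norm_num)) sqrt_two_le (by norm_num) (by norm_num)

/-- Tier-2 vertex FRONTIER cell `(β_W, ε) = (11 / 20, .027)` at `κ = log(6/5)`: `AreaLawOnBallW 2 4 (11 / 40) (log(6/5)) (27 / 500) (27 / 1000) mv`,
every `mv ≥ 1`; `ε` maximal at `1/1000` under the certificate form. [folklore] -/
theorem su2_areaLawOnBallW_frontier_elevenTwentieths {mv : ℕ} (hmv : 1 ≤ mv) :
    AreaLawOnBallW 2 4 (11 / 40) (Real.log (6 / 5)) (27 / 500) (27 / 1000) mv := by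
  rw [show (11 / 40 : ℝ) = 11 / 20 / 2 by norm_num]
  refine su2_areaLawOnBallW_vertex_of_row (βW := 11 / 20) (by norm_num) (by norm_num) (Real.log_pos (by norm_num)) (by norm_num) hmv ?_
  exact rhoFR_two_lt_one_of_bounds (by norm_num) (by norm_num) exp_log_six_fifths_div_three_le
    (exp_le_taylor4 (x := 27 / 500) (by norm_num) (by norm_num)) sqrt_two_le (by norm_num) (by norm_num)

/-- Tier-2 vertex FRONTIER cell `(β_W, ε) = (3 / 5, .009)` at `κ = log(6/5)`: `AreaLawOnBallW 2 4 (3 / 10) (log(6/5)) (9 / 500) (9 / 1000) mv`,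
every `mv ≥ 1`; `ε` maximal at `1/1000` under the certificate form. [folklore] -/
theorem su2_areaLawOnBallW_frontier_threeFifths {mv : ℕ} (hmv : 1 ≤ mv) :
    AreaLawOnBallW 2 4 (3 / 10) (Real.log (6 / 5)) (9 / 500) (9 / 1000) mv := by
  rw [show (3 / 10 : ℝ) = 3 / 5 / 2 by norm_num]
  refine su2_areaLawOnBallW_vertex_of_row (βW := 3 / 5) (by norm_num) (by norm_num) (Real.log_pos (by norm_num)) (by norm_num) hmv ?_
  exact rhoFR_two_lt_one_of_bounds (by norm_num) (by norm_num) exp_log_six_fifths_div_three_le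
    (exp_le_taylor4 (x := 9 / 500) (by norm_num) (by norm_num)) sqrt_two_le (by norm_num) (by norm_num)

end Summit.Ventures.YMGap.RobustBall

end
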